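import Mathlib
import Summits.AnomalousDissipation.AnomalousDissipation.Theorems.LimitingAbsorptionFloorUpgradeStubCosTransformNonneg
import HarnessLib

/-!
# Fourier inversion in cosine form and the tail estimate (stub A3)

Crux `LimitingAbsorption.FloorUpgrade` (stmt-AnomalousDissipation-15010), line `SketchIdeator1`,
stub `stub_cosTransform_inversion`: for a continuous, even, exponentially bounded function
`C : ℝ → ℝ` whose cosine transform `ρ(ξ) = ∫₀^∞ C(σ) cos(ξσ) dσ` is nonnegative and
integrable,

* (inversion) `C(τ) = π⁻¹ ∫_ℝ ρ(ξ) cos(ξτ) dξ` for every `τ` (e.g. `C = e^{-|τ|}`,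
  `ρ = 1/(1+ξ²)`, `π⁻¹ ∫ cos(ξτ)/(1+ξ²) dξ = e^{-|τ|}`);
* (tail estimate) for `u > 0`, `∫_{|uξ| ≥ 2} ρ ≤ (π/u) ∫_{-u}^{u} (C(0) - C(τ)) dτ`.

Route: `𝓕 C (w) = 2ρ(2πw)` (real part: A1's `CosTransformNonneg.re_fourier_ofReal_eq`;
imaginary part vanishes by oddness), hence `𝓕 C ∈ L¹` by rescaling the integrability of `ρ`;
Mathlib's Fourier inversion `Continuous.fourierInv_fourier_eq`, real parts, and the substitution
`ξ = 2πw`. For the tail: `π (C 0 - C τ) = ∫ ρ(ξ)(1 - cos ξτ) dξ`, integrate over `τ ∈ [-u, u]`,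
swap (Fubini), and use `K(ξ) = ∫_{-u}^{u} (1 - cos ξτ) dτ = 2u - 2 sin(uξ)/ξ ≥ u` on
`{2 ≤ |uξ|}`, `K ≥ 0` everywhere, `ρ ≥ 0`.
-/

set_option linter.dupNamespace false

noncomputable section

open MeasureTheory Set Filter Topology
open scoped BigOperators FourierTransform

namespace Summit.AnomalousDissipation.AnomalousDissipation.Theorems.FloorUpgradeLine

namespace CosTransformInversion

open CosTransformNonneg

/-- For an integrable, even real function, the Fourier transform of its complexification is
real: `im 𝓕 C (w) = -∫ C(v) sin(2π v w) dv = 0`, the integrand being odd. [folklore] -/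
theorem im_fourier_ofReal_eq_zero (C : ℝ → ℝ) (hint : Integrable C)
    (heven : ∀ τ, C (-τ) = C τ) (w : ℝ) :
    (𝓕 (fun τ : ℝ => (C τ : ℂ)) w).im = 0 := by
  rw [Real.fourier_real_eq_integral_exp_smul]
  have hi : Integrable (fun v : ℝ =>
      Complex.exp (↑(-2 * Real.pi * v * w) * Complex.I) • ((C v : ℝ) : ℂ)) := by
    have hexp : Continuous fun v : ℝ => Complex.exp (↑(-2 * Real.pi * v * w) * Complex.I) := by
      fun_prop
    refine Integrable.mono' hint.norm
      (hexp.aestronglyMeasurable.smul hint.ofReal.aestronglyMeasurable)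
      (ae_of_all _ fun v => le_of_eq ?_)
    rw [smul_eq_mul, norm_mul, Complex.norm_exp_ofReal_mul_I, one_mul, Complex.norm_real]
  have hpt : ∀ v : ℝ,
      RCLike.im (Complex.exp (↑(-2 * Real.pi * v * w) * Complex.I) • ((C v : ℝ) : ℂ)) =
        Real.sin (-2 * Real.pi * v * w) * C v := by
    intro v
    simp only [RCLike.im_to_complex, smul_eq_mul, Complex.im_mul_ofReal,
      Complex.exp_ofReal_mul_I_im]
  have hodd : ∀ v : ℝ, Real.sin (-2 * Real.pi * (-v) * w) * C (-v) =
      -(Real.sin (-2 * Real.pi * v * w) * C v) := fun v => by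
    rw [heven, show -2 * Real.pi * (-v) * w = -(-2 * Real.pi * v * w) by ring, Real.sin_neg]
    ring
  rw [← RCLike.im_to_complex, ← integral_im hi]
  simp only [hpt]
  have h1 : ∫ v, Real.sin (-2 * Real.pi * (-v) * w) * C (-v) =
      ∫ v, Real.sin (-2 * Real.pi * v * w) * C v :=
    integral_neg_eq_self (fun v => Real.sin (-2 * Real.pi * v * w) * C v) volume
  have h2 : ∫ v, Real.sin (-2 * Real.pi * (-v) * w) * C (-v) =
      -∫ v, Real.sin (-2 * Real.pi * v * w) * C v := by
    simp only [hodd]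
    exact integral_neg _
  linarith

/-- For a continuous, integrable, even real function, the Fourier transform of its
complexification is the real number `2 ∫_{τ>0} C τ cos(2π w τ) dτ` (twice the half-line cosine
transform at `2πw`). [folklore] -/
theorem fourier_ofReal_eq (C : ℝ → ℝ) (hC : Continuous C) (hint : Integrable C)
    (heven : ∀ τ, C (-τ) = C τ) (w : ℝ) :
    𝓕 (fun τ : ℝ => (C τ : ℂ)) w =
      ((2 * ∫ τ in Ioi (0 : ℝ), C τ * Real.cos (2 * Real.pi * w * τ) : ℝ) : ℂ) := by
  apply Complex.ext
  · rw [Complex.ofReal_re]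
    exact re_fourier_ofReal_eq C hC hint heven w
  · rw [Complex.ofReal_im]
    exact im_fourier_ofReal_eq_zero C hint heven w

/-- **Fourier inversion in cosine form.** For a continuous, integrable, even real `C` whose
cosine transform `ρ(ξ) = ∫₀^∞ C(σ) cos(ξσ) dσ` is integrable,
`C(τ) = π⁻¹ ∫ ρ(ξ) cos(ξτ) dξ` for every `τ`: `𝓕 C (w) = 2ρ(2πw)` is integrable, Mathlib's
`Continuous.fourierInv_fourier_eq` gives `C = 𝓕⁻ 𝓕 C`, and one takes real parts and
substitutes `ξ = 2πw`. [folklore] -/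
theorem inversion (C : ℝ → ℝ) (hC : Continuous C) (hCi : Integrable C)
    (heven : ∀ τ, C (-τ) = C τ)
    (hint : Integrable (fun ξ : ℝ => ∫ τ in Ioi (0 : ℝ), C τ * Real.cos (ξ * τ))) (τ : ℝ) :
    C τ = Real.pi⁻¹ *
        ∫ ξ, (∫ σ in Ioi (0 : ℝ), C σ * Real.cos (ξ * σ)) * Real.cos (ξ * τ) := by
  set ρ : ℝ → ℝ := fun ξ => ∫ σ in Ioi (0 : ℝ), C σ * Real.cos (ξ * σ) with hρ
  have hfc : Continuous fun t : ℝ => (C t : ℂ) := by fun_prop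
  have hfi : Integrable fun t : ℝ => (C t : ℂ) := hCi.ofReal
  have hF : ∀ w, 𝓕 (fun t : ℝ => (C t : ℂ)) w = ((2 * ρ (2 * Real.pi * w) : ℝ) : ℂ) :=
    fun w => fourier_ofReal_eq C hC hCi heven w
  have h2π : (2 * Real.pi : ℝ) ≠ 0 := by positivity
  have hsc : Integrable (fun w : ℝ => 2 * ρ (2 * Real.pi * w)) :=
    (hint.comp_mul_left' h2π).const_mul 2
  have hFi : Integrable (𝓕 (fun t : ℝ => (C t : ℂ))) :=
    hsc.ofReal.congr (ae_of_all _ fun w => (hF w).symm)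
  have hinv : 𝓕⁻ (𝓕 (fun t : ℝ => (C t : ℂ))) = fun t : ℝ => (C t : ℂ) :=
    hfc.fourierInv_fourier_eq hfi hFi
  -- unpack the inverse transform at `τ`
  have h1 : (C τ : ℂ) = ∫ v, Complex.exp (↑(-2 * Real.pi * v * -τ) * Complex.I) •
      ((2 * ρ (2 * Real.pi * v) : ℝ) : ℂ) := by
    have h : (fun t : ℝ => (C t : ℂ)) τ = 𝓕 (𝓕 (fun t : ℝ => (C t : ℂ))) (-τ) := by
      rw [← Real.fourierInv_eq_fourier_neg, hinv]
    rw [Real.fourier_real_eq_integral_exp_smul] at h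
    simp only [hF] at h
    exact h
  have hI : Integrable (fun v : ℝ => Complex.exp (↑(-2 * Real.pi * v * -τ) * Complex.I) •
      ((2 * ρ (2 * Real.pi * v) : ℝ) : ℂ)) := by
    have hexp : Continuous fun v : ℝ => Complex.exp (↑(-2 * Real.pi * v * -τ) * Complex.I) := by
      fun_prop
    refine Integrable.mono' hsc.norm
      (hexp.aestronglyMeasurable.smul hsc.ofReal.aestronglyMeasurable)
      (ae_of_all _ fun v => le_of_eq ?_)
    rw [smul_eq_mul, norm_mul, Complex.norm_exp_ofReal_mul_I, one_mul, Complex.norm_real]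
  have h2 : C τ = ∫ v, 2 * (ρ (2 * Real.pi * v) * Real.cos (2 * Real.pi * v * τ)) := by
    have h := congrArg Complex.re h1
    rw [Complex.ofReal_re] at h
    rw [h, ← RCLike.re_to_complex, ← integral_re hI]
    refine integral_congr_ae (ae_of_all _ fun v => ?_)
    simp only [RCLike.re_to_complex, smul_eq_mul, Complex.re_mul_ofReal,
      Complex.exp_ofReal_mul_I_re]
    rw [show -2 * Real.pi * v * -τ = 2 * Real.pi * v * τ by ring]
    ring
  have h3 : ∫ v, ρ (2 * Real.pi * v) * Real.cos (2 * Real.pi * v * τ) =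
      |(2 * Real.pi)⁻¹| * ∫ ξ, ρ ξ * Real.cos (ξ * τ) :=
    Measure.integral_comp_mul_left (fun ξ => ρ ξ * Real.cos (ξ * τ)) (2 * Real.pi)
  rw [h2, integral_const_mul, h3, abs_of_pos (inv_pos.2 (by positivity)), mul_inv, ← mul_assoc,
    ← mul_assoc, mul_inv_cancel₀ (two_ne_zero), one_mul]

/-- **The tail estimate.** If `ρ ≥ 0` is integrable and `C(τ) = π⁻¹ ∫ ρ(ξ) cos(ξτ) dξ` for
every `τ`, then for `u > 0`, `∫_{2 ≤ |uξ|} ρ ≤ (π/u) ∫_{-u}^{u} (C 0 - C τ) dτ`: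
`π (C 0 - C τ) = ∫ ρ(ξ) (1 - cos ξτ) dξ`, integrate over `τ ∈ [-u, u]` and swap (Fubini);
the kernel `K(ξ) = ∫_{-u}^{u} (1 - cos ξτ) dτ = 2u - 2 sin(uξ)/ξ` is nonnegative and at least
`u` on `{2 ≤ |uξ|}`. [folklore] -/
theorem tail (C ρ : ℝ → ℝ) (hnonneg : ∀ ξ, 0 ≤ ρ ξ) (hint : Integrable ρ)
    (hinvC : ∀ τ : ℝ, C τ = Real.pi⁻¹ * ∫ ξ, ρ ξ * Real.cos (ξ * τ)) (u : ℝ) (hu : 0 < u) :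
    ∫ ξ in {ξ : ℝ | 2 ≤ |u * ξ|}, ρ ξ ≤ Real.pi / u * ∫ τ in -u..u, (C 0 - C τ) := by
  have hSm : MeasurableSet {ξ : ℝ | 2 ≤ |u * ξ|} :=
    (isClosed_le continuous_const (continuous_abs.comp (continuous_const.mul continuous_id))
      ).measurableSet
  -- pointwise: `π (C 0 - C τ) = ∫ ρ (1 - cos)`
  have hdiff : ∀ τ, Real.pi * (C 0 - C τ) = ∫ ξ, ρ ξ * (1 - Real.cos (ξ * τ)) := by
    intro τ
    have hIcos : Integrable fun ξ => ρ ξ * Real.cos (ξ * τ) :=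
      hint.mul_bdd (Continuous.aestronglyMeasurable (by fun_prop))
        (ae_of_all _ fun ξ => by
          rw [Real.norm_eq_abs]
          exact Real.abs_cos_le_one _)
    rw [hinvC 0, hinvC τ]
    simp only [mul_zero, Real.cos_zero, mul_one]
    rw [← mul_sub, ← mul_assoc, mul_inv_cancel₀ Real.pi_pos.ne', one_mul,
      ← integral_sub hint hIcos]
    refine integral_congr_ae (ae_of_all _ fun ξ => ?_)
    ring
  -- Fubini
  have hFi : Integrable (Function.uncurry fun (τ ξ : ℝ) => ρ ξ * (1 - Real.cos (ξ * τ)))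
      ((volume.restrict (Ioc (-u) u)).prod volume) := by
    have hdom : Integrable (fun p : ℝ × ℝ => 2 * ‖ρ p.2‖)
        ((volume.restrict (Ioc (-u) u)).prod volume) :=
      (hint.norm.const_mul 2).comp_snd _
    refine hdom.mono' ?_ (ae_of_all _ fun p => ?_)
    · exact ((hint.comp_snd (volume.restrict (Ioc (-u) u))).aestronglyMeasurable).mul
        (Continuous.aestronglyMeasurable (by fun_prop))
    · rcases p with ⟨τ, ξ⟩
      show ‖ρ ξ * (1 - Real.cos (ξ * τ))‖ ≤ 2 * ‖ρ ξ‖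
      rw [norm_mul, mul_comm]
      refine mul_le_mul_of_nonneg_right ?_ (norm_nonneg _)
      rw [Real.norm_eq_abs, abs_le]
      constructor <;> nlinarith [Real.cos_le_one (ξ * τ), Real.neg_one_le_cos (ξ * τ)]
  have hswap : ∫ τ in Ioc (-u) u, ∫ ξ, ρ ξ * (1 - Real.cos (ξ * τ)) =
      ∫ ξ, ∫ τ in Ioc (-u) u, ρ ξ * (1 - Real.cos (ξ * τ)) :=
    integral_integral_swap hFi
  have hGi : Integrable fun ξ : ℝ => ∫ τ in Ioc (-u) u, ρ ξ * (1 - Real.cos (ξ * τ)) :=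
    hFi.integral_prod_right
  -- the kernel
  have hK0 : ∀ ξ : ℝ, 0 ≤ ∫ τ in Ioc (-u) u, (1 - Real.cos (ξ * τ)) := fun ξ =>
    setIntegral_nonneg measurableSet_Ioc fun τ _ => sub_nonneg.2 (Real.cos_le_one _)
  have hKS : ∀ ξ ∈ {ξ : ℝ | 2 ≤ |u * ξ|}, u ≤ ∫ τ in Ioc (-u) u, (1 - Real.cos (ξ * τ)) := by
    intro ξ hξ
    have hξ' : 2 ≤ u * |ξ| := by
      have h : 2 ≤ |u * ξ| := hξ
      rwa [abs_mul, abs_of_pos hu] at h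
    have hξ0 : ξ ≠ 0 := by
      rintro rfl
      rw [abs_zero, mul_zero] at hξ'
      linarith
    have hci : IntervalIntegrable (fun τ : ℝ => Real.cos (ξ * τ)) volume (-u) u :=
      (Continuous.intervalIntegrable (by fun_prop) _ _)
    rw [← intervalIntegral.integral_of_le (by linarith : -u ≤ u),
      intervalIntegral.integral_sub intervalIntegrable_const hci, intervalIntegral.integral_const,
      smul_eq_mul, mul_one]
    have hJ : ξ * ∫ τ in -u..u, Real.cos (ξ * τ) = Real.sin (ξ * u) - Real.sin (ξ * -u) := by
      rw [← smul_eq_mul, intervalIntegral.smul_integral_comp_mul_left, integral_cos]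
    have hJ2 : |ξ| * |∫ τ in -u..u, Real.cos (ξ * τ)| ≤ 2 := by
      rw [← abs_mul, hJ, mul_neg, Real.sin_neg, sub_neg_eq_add, ← two_mul, abs_mul, abs_two]
      linarith [Real.abs_sin_le_one (ξ * u)]
    have hJu : |∫ τ in -u..u, Real.cos (ξ * τ)| ≤ u :=
      le_of_mul_le_mul_left (hJ2.trans (hξ'.trans_eq (mul_comm _ _))) (abs_pos.2 hξ0)
    linarith [le_abs_self (∫ τ in -u..u, Real.cos (ξ * τ))]
  -- the main chain
  have hmain : u * ∫ ξ in {ξ : ℝ | 2 ≤ |u * ξ|}, ρ ξ ≤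
      ∫ ξ, ∫ τ in Ioc (-u) u, ρ ξ * (1 - Real.cos (ξ * τ)) := by
    calc u * ∫ ξ in {ξ : ℝ | 2 ≤ |u * ξ|}, ρ ξ
        = ∫ ξ, {ξ : ℝ | 2 ≤ |u * ξ|}.indicator (fun ξ => u * ρ ξ) ξ := by
          rw [integral_indicator hSm, integral_const_mul]
      _ ≤ ∫ ξ, ∫ τ in Ioc (-u) u, ρ ξ * (1 - Real.cos (ξ * τ)) := by
          refine integral_mono_of_nonneg (ae_of_all _ fun ξ => ?_) hGi (ae_of_all _ fun ξ => ?_)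
          · exact Set.indicator_nonneg (fun ξ _ => mul_nonneg hu.le (hnonneg ξ)) ξ
          · show {ξ : ℝ | 2 ≤ |u * ξ|}.indicator (fun ξ => u * ρ ξ) ξ ≤
              ∫ τ in Ioc (-u) u, ρ ξ * (1 - Real.cos (ξ * τ))
            rw [integral_const_mul]
            by_cases hξ : ξ ∈ {ξ : ℝ | 2 ≤ |u * ξ|}
            · rw [Set.indicator_of_mem hξ, mul_comm]
              exact mul_le_mul_of_nonneg_left (hKS ξ hξ) (hnonneg ξ)
            · rw [Set.indicator_of_notMem hξ]
              exact mul_nonneg (hnonneg ξ) (hK0 ξ)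
  have hId : ∫ τ in Ioc (-u) u, ∫ ξ, ρ ξ * (1 - Real.cos (ξ * τ)) =
      Real.pi * ∫ τ in -u..u, (C 0 - C τ) := by
    rw [intervalIntegral.integral_of_le (by linarith : -u ≤ u), ← integral_const_mul]
    exact setIntegral_congr_fun measurableSet_Ioc fun τ _ => (hdiff τ).symm
  rw [div_mul_eq_mul_div, le_div_iff₀ hu, mul_comm]
  calc u * ∫ ξ in {ξ : ℝ | 2 ≤ |u * ξ|}, ρ ξ
      ≤ ∫ ξ, ∫ τ in Ioc (-u) u, ρ ξ * (1 - Real.cos (ξ * τ)) := hmain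
    _ = Real.pi * ∫ τ in -u..u, (C 0 - C τ) := by rw [← hswap, hId]

end CosTransformInversion

open CosTransformNonneg CosTransformInversion in
/-- **A3.** Fourier inversion in cosine form and the classical tail estimate for a continuous,
even, exponentially bounded function `C` with nonnegative integrable cosine transform
`ρ(ξ) = ∫₀^∞ C(σ) cos(ξσ) dσ`: (a) `C(τ) = π⁻¹ ∫ ρ(ξ) cos(ξτ) dξ` for every `τ`
(`𝓕 C = 2ρ(2π·)` and Mathlib's `Continuous.fourierInv_fourier_eq`); (b) for `u > 0`,
`∫_{2 ≤ |uξ|} ρ ≤ (π/u) ∫_{-u}^{u} (C 0 - C τ) dτ` (integrate (a) at `0` minus (a) at `τ` over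
`[-u, u]`, Fubini, and `∫_{-u}^{u} (1 - cos ξτ) dτ ≥ u` on the tail set). [folklore] -/
theorem stub_cosTransform_inversion (C : ℝ → ℝ) (A γ : ℝ) (hC : Continuous C) (hγ : 0 < γ)
    (heven : ∀ τ, C (-τ) = C τ)
    (hA : ∀ τ, |C τ| ≤ A * Real.exp (-(γ * |τ|)))
    (hnonneg : ∀ ξ : ℝ, 0 ≤ ∫ τ in Ioi (0 : ℝ), C τ * Real.cos (ξ * τ))
    (hint : Integrable (fun ξ : ℝ => ∫ τ in Ioi (0 : ℝ), C τ * Real.cos (ξ * τ))) :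
    (∀ τ : ℝ, C τ = Real.pi⁻¹ *
        ∫ ξ, (∫ σ in Ioi (0 : ℝ), C σ * Real.cos (ξ * σ)) * Real.cos (ξ * τ)) ∧
    (∀ u : ℝ, 0 < u →
        ∫ ξ in {ξ : ℝ | 2 ≤ |u * ξ|}, (∫ σ in Ioi (0 : ℝ), C σ * Real.cos (ξ * σ)) ≤
          Real.pi / u * ∫ τ in -u..u, (C 0 - C τ)) := by
  have hCi : Integrable C := integrable_of_abs_le_exp C A γ hC hγ hA
  have hinvC : ∀ τ : ℝ, C τ = Real.pi⁻¹ *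
      ∫ ξ, (∫ σ in Ioi (0 : ℝ), C σ * Real.cos (ξ * σ)) * Real.cos (ξ * τ) :=
    fun τ => inversion C hC hCi heven hint τ
  exact ⟨hinvC, fun u hu =>
    tail C (fun ξ => ∫ σ in Ioi (0 : ℝ), C σ * Real.cos (ξ * σ)) hnonneg hint hinvC u hu⟩

end Summit.AnomalousDissipation.AnomalousDissipation.Theorems.FloorUpgradeLine

end
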